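import Summits.BirchSwinnertonDyer.Rank1Residual.X1.StrictAtPOfInertia
import Summits.BirchSwinnertonDyer.Rank1Residual.X1.KerH1IsoCocycle
import HarnessLib

/-!
# The socket at `p` for the local term at layer `n`, II: classes over `ℚ_n`
# (cell `b2b-bsdres`, unit `b2b-bsdres-eisenstein-p1`, gen 18; X1R0-GAPMAP §27.3, memo §4.5/§4.8 (R1′))

HONEST FRAMING (run/shared/lean/b2b/bsd-rank1-residual/, verbatim in every file): the goal of the
cell is to DELETE the COMBINATION-SHAPED residual classes of the Birch–Swinnerton-Dyer formula for
ALL analytic-rank `≤ 1` elliptic curves over `ℚ` — "full BSD formula for every rank `≤ 1` curve in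
class `C`" assembled STRICTLY from published theorems — so that the rank-`≤ 1` remainder becomes
exactly the CONSTRUCTION-SHAPED classes, which are TYPED (missing-input `Prop`s), NOT attempted.
This is not "finishing BSD". Sub-cell `b2b-bsdres-eisenstein-p1`: research route; NO CLAIM BEYOND
STATED CLASSES; nothing here changes a label; nothing is booked. THEOREMS ONLY; Greenberg's Prop. 2.4
(`imKummer_ge_strictCondition_goodOrdinary`) / the Coates–Greenberg record carried as HYPOTHESES.

What. FILE 19 (`X1/StrictAtPOfInertia`) + FILE 20 (`X1/KerH1IsoCocycle`) composed: for a class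
`y = [φ] ∈ H¹(ℚ_n, E_{ℚ_n}[p])` of the base-changed curve over `ℚ_n = κ.layer n`, its transport
`kerH1Iso (h_0 (res (Ψ y)))` (the class the layer-`n` count files handle) satisfies the Kummer
condition over `ℚ_∞` at `v ∋ p` as soon as `red_v(β⁻¹ φ(x)) = Õ` for every `x ∈ I_v ∩ ker κ`
(`β = primaryBaseChangeEquiv`, `x` viewed in `Gal(ℚ̄_n/ℚ_n)` through `kerOfKer`). This is the exact
form in which the intermediate local condition `𝓛` at the prime of `ℚ_n` over `p` (route R1′ of
`V76-LOCAL-TERM-PLAN.md`) must control a class; the remaining work for the local term `a` is local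
(`𝓛`, `𝓚 ≤ 𝓛`, its index) plus the identification of `I_v ∩ ker κ` with the inertia of `(ℚ_n)_𝔭`.

References: [GreenbergLNM1716] §2 Prop. 2.4, §3 Lemma 3.4; [SerreGaloisCohomology1997] I.§2.4.
-/

set_option autoImplicit false

noncomputable section

open scoped Classical

universe u

open Function Field NumberField IsDedekindDomain WeierstrassCurve PowerSeries
  Literature.NumberTheory.EllipticCurves Literature.NumberTheory.GaloisRepresentations
  Literature.NumberTheory.GaloisCohomology
  Literature.NumberTheory.EllipticCurves.IwasawaAlgebra IsLocalRing
  Summit.BirchSwinnertonDyer.Rank1Residual.Additive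
  Summit.BirchSwinnertonDyer.Rank1Residual.Additive.ZpTower
open Literature.NumberTheory.EllipticCurves.Greenberg1999 (imKummer_ge_strictCondition_goodOrdinary)
open Literature.NumberTheory.EllipticCurves.GreenbergSelmer (inertiaIn inertiaInToH)
open Summit.BirchSwinnertonDyer.Rank1Residual.X2.GreenbergVatsalReductionDatum (localRed reductionDatum)

namespace Summit.BirchSwinnertonDyer.Rank1Residual.X1.StrictAtPOfInertiaTransported

variable (W : WeierstrassCurve ℚ) [W.IsElliptic] [W.IsGloballyMinimal] {p : ℕ} [hp : Fact p.Prime]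
  (κ : ZpExtension ℚ p) (n : ℕ) (κn : ZpExtension (κ.layer n) p)
  (hκn : ∀ σ : Field.absoluteGaloisGroup (κ.layer n),
    (κn σ).toAdd * (p : ℤ_[p]) ^ n = (κ (resGal (K := ℚ) (κ.layer n) σ)).toAdd)

/-- **The socket at `p` for a class over `ℚ_n`** (route R1′), Greenberg's Prop. 2.4 BY NAME (`hGrK`).
[cite: GreenbergLNM1716, §2 Prop. 2.4 (pp. 74–75)] -/
theorem kerH1Iso_layerToInfty_mem_localKerOver
    (hGrK : imKummer_ge_strictCondition_goodOrdinary)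
    (hΔ : ¬ (p : ℤ) ∣ minimalDiscriminantInt W) (hord : ¬ (p : ℤ) ∣ W.frobeniusTrace p)
    (hκ : κ.IsCyclotomic) (v : HeightOneSpectrum (𝓞 ℚ)) (hpv : ((p : ℕ) : 𝓞 ℚ) ∈ v.asIdeal)
    (φ : contOneCocycles (discreteTopRep (Field.absoluteGaloisGroup (κ.layer n))
      (geomTorsion (W.baseChange (κ.layer n)) (p : ℤ))))
    (hφ : ∀ x : inertiaIn κ.kerSubgroup v,
      localRed W p hpv hΔ (pointsMap W (v.adicCompletion ℚ)
        (((primaryBaseChangeEquiv (κ.layer n) W p).symm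
          (AddSubgroup.inclusion (geomTorsion_le_geomPrimaryTorsion (W.baseChange (κ.layer n)) p)
            (φ.1 ((kerOfKer κ n κn hκn (inertiaInToH κ.kerSubgroup v x) : κn.kerSubgroup) :
              Field.absoluteGaloisGroup (κ.layer n)))) : W.geomPrimaryTorsion p) : W.geomPoints)) = 0) :
    kerH1Iso W κ n κn hκn ((W.baseChange (κ.layer n)).layerToInfty κn 0
      (resH1Hom (Literature.NumberTheory.EllipticCurves.subgroupIncl (κn.layerSubgroup 0))
        (AddMonoidHom.id (geomPrimaryTorsion (W.baseChange (κ.layer n)) p)) (fun _ _ ↦ rfl)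
        (torsionToPrimaryH1 (W.baseChange (κ.layer n)) p (oneCocycleClass _ φ)))) ∈
      W.localKerOver p κ.kerSubgroup (v.adicCompletion ℚ) := by
  obtain ⟨F, hF, hFval⟩ := KerH1IsoCocycle.exists_cocycle_kerH1Iso_layerToInfty W κ n κn hκn φ
  refine StrictAtPOfInertia.mem_localKerOver_of_exists_cocycle W p hGrK hΔ hord κ hκ v hpv _
    ⟨F, hF.symm, fun x ↦ ?_⟩
  rw [hFval]
  exact hφ x

end Summit.BirchSwinnertonDyer.Rank1Residual.X1.StrictAtPOfInertiaTransported

end
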